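import Mathlib
import HarnessLib
import HarnessLib.Audit
import Summits.HodgeConjecture.Statement
import Literature.AlgebraicGeometry.HodgeTheory.HodgeModelExistence
import Literature.AlgebraicGeometry.HodgeTheory.GysinFormalism
import Literature.AlgebraicGeometry.Motives.FamiliesVHS
import Literature.AlgebraicGeometry.Motives.BaseChange
import Summits.HodgeConjecture.HodgeConjecture.Theorems.NodalSupportHodgeModels

/-!
Route: QbarEnvelope

DORMANT since 2026-08-24T20:44:29Z (reconciler: no traction for 7.1 d (last activity item-evidence-added at 2026-08-17T18:45:21Z); parked, not closed — `ledger route dormant route-HodgeConjecture-QbarEnvelope --off` to reactivate) — unstaffed, not closed; items shared with open routes are served there. `ledger route dormant <id> --off` reactivates.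

X (it suffices to show): (C2 = QbarEnvelope) every rational (p,p) class c on a smooth projective
complex variety X is a pull-back ι^*c' along SOME ℂ-morphism ι : X ⟶ W of a rational (p,p) class c'
on a smooth projective variety W DEFINABLE OVER A NUMBER FIELD (a "ℚ̄-envelope" of the Hodge class);
and (C1 = HCOverNumberFields) the Hodge conjecture for smooth projective complex varieties definable
over a number field.
Lean (real carriers only; Sketch.lean `lean check` rc 0): `QbarEnvelope ∧ HCOverNumberFields`, with
QbarEnvelope := ∀ n X, IsSmoothProjective n X → ∀ p (c : complexBetti X (2*p)), IsRationalClass c →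
IsOfHodgeType n X (2*p) p p c → ∃ m W (ι : X ⟶ W) c', IsSmoothProjective m W ∧ (∃ K [NumberField K]
(σ : K →+* ℂ) W₀, Nonempty (W ≅ (baseChangeHom σ).obj W₀)) ∧ IsRationalClass c' ∧ IsOfHodgeType m W
(2*p) p p c' ∧ complexBetti.map ι (2*p) c' = c.
Assembly: (∀ n X, nonempty_hodgeModel n X) → PullbackAlgebraic → QbarEnvelope → HCOverNumberFields →
HodgeConjecture — take the envelope (W, ι, c'), apply C1 to W, pull back (support item
PullbackAlgebraic: pull-back along a morphism of smooth projective varieties preserves algebraic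
classes; Fulton refined Gysin pull-back + Cor. 19.2).

Rationale: WHY THIS LINE (arithmetic brought to bear). Voisin2007HodgeLoci (Prop. 1.2, Thm 1.5, Prop. 1.7) =
CharlesSchnell2014Notes Thm 11.3.19 (held book cattani2014 p0489, READ): if the image in the base of
the Hodge-locus component through (X, α) is defined over ℚ̄, the global invariant cycle theorem
applied to a ℚ̄-compactification of the family over that component makes α the restriction of a
Hodge class on a smooth projective ℚ̄-variety — our C2 records exactly this OUTPUT as a statement on
real carriers, with no Hodge-locus vocabulary (which the tree lacks): α = ι^*α̃, W over a number
field. C2 ⇐ "Hodge-locus components are defined over ℚ̄" ⇐ "Hodge classes are (weakly) absolute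
Hodge" (Voisin2007HodgeLoci Thm 0.5/0.6; Deligne's Conj = CharlesSchnell2014Notes 11.2.17 + Thm
11.3.17), and HC ⇒ C2 (Hodge locus = algebraicity locus, a countable union of ℚ̄-subvarieties).
Given C2, HC collapses to varieties over number fields (C1), where a Hodge class has incarnations
unavailable at a transcendental point: algebraic de Rham class over K, crystalline Frobenii at all
good primes, ONE ℓ-adic Galois representation — so Tate + Mumford–Tate (Moonen2017FamiliesMotives),
p-adic variational methods (BlochEsnaultKerz2014pAdic) and CM/Shimura-theoretic tools apply.
Unconditional progress on the field-of-definition side exists: KlinglerOtwinowskaUrbanik2023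
(positive period dimension, level ≥ 3), BaldiKlinglerUllmo2024.
RANKED CRUXES. #2 QbarEnvelope (the transcendence content: where a refutation would live — a Hodge
class at a transcendental isolated point of its Hodge locus with no ℚ̄-model); #3 HCOverNumberFields
(still "a Hodge conjecture", but the decisive open family — CM abelian varieties of Weil type,
Weil's candidate counterexamples — lies inside it: algebraicity of Weil classes known in dim 4 and
partially 6, Markman2025SecantWeil, arXiv:2603.20268; by Deligne1982HodgeCycles + André 1992 every
Hodge class on a CM abelian variety comes from Weil classes). SUPPORT: PullbackAlgebraic (rank 9,
theorem in print), Target, Assembly (provable by logic once the items are hypotheses).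
KILL CRITERIA. Refutation of C2 (an explicit Hodge class with NO ℚ̄-envelope — equivalently, via
CDK, a Hodge-locus component of a ℚ-family not defined over ℚ̄ carrying an isolated class) refutes
HC itself and closes every route; refutation of C1 likewise. The route DIES AS A STRATEGY (close:
exhausted) if C2 turns out provably EQUIVALENT to Deligne's absoluteness conjecture with no
independent handle (then it is bookkeeping), or if KOU-type definability provably cannot reach
zero-dimensional components.
NOT DECOMPOSED YET (tenure): split of C2 by period dimension of the Hodge-locus component (positive:
KOU/BKU o-minimal definability; zero: rigid pairs ⇒ the point itself should be a ℚ̄-point — the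
genuinely dark case); split of C1 into "Hodge ⇒ Tate (absolute Hodge over ℚ̄)" ∧ "Tate conjecture
over number fields" (needs real-carrier ℓ-adic/absolute-Hodge vocabulary: definition requests
filed); Weil-class algebraicity in all dimensions as the first special case of C1.

Novelty: Nearest prior art (searched this session: lit search --hybrid "Hodge loci absolute Hodge classes
Voisin weakly absolute number fields" → held book cattani2014 pp.485–490 READ (Charles–Schnell Thm
11.3.15–11.3.19, Cor. 11.3.16–11.3.18); Voisin2007HodgeLoci = doi:10.1112/S0010437X07002837 (Prop.
1.2, Thm 1.5, Prop. 1.7: "HC for varieties over ℚ̄ + hypotheses of 1.5(2) ⇒ α algebraic");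
KlinglerOtwinowskaUrbanik2023 = arXiv:2010.03359 (Thm 1.12/Cor. 1.13–1.14); BaldiKlinglerUllmo2024;
idea card qbar-anchors-kou-andre-motivated (graded variant of Voisin 1.7, motivated currency); lit
frontier HodgeConjecture --since 2020 (arXiv:2603.20268, arXiv:2605.20453). Delta: NONE in mechanism
— this is Voisin's funnel opened as the arithmetic FRAME of the summit (expected grade
known/variant). What is added: (i) the envelope statement C2 on the tree's REAL carriers (pull-back
from a ℚ̄-variety; no Hodge-locus / absolute-Hodge vocabulary needed, yet implied by HC and implying
HC given C1), so provers/refuters can bite today; (ii) the explicit real-typed HCOverNumberFields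
item where the p-adic / Galois / CM cards (supersingular-isotypic-lift,
padic-semiregular-object-lifting, adelic-coherence-attractor-planes,
qbar-anchors-kou-andre-motivated) dedup; (iii) kill criteria tied to the zero-dimensional
Hodge-locus case. Cross-field import: arithmetic geometry (fields of definition, Galois/crystalline
incarnations) into a transcendental statement.  [refs: 10.1112/S0010437X07002837, 2010.03359, 2603.20268, 2605.20453, doi:10.1112/S0010437X07002837, KlinglerOtwinowskaUrbanik2023, BaldiKlinglerUllmo2024]

Barriers (technique_class: arithmetic-descent, field-of-definition-of-hodge-loci): technique_class: arithmetic-descent, field-of-definition-of-hodge-loci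
- Literature.Barriers.HodgeConjecture.hodgeClassesAreAbsoluteFor_abelianVariety (Deligne 1982: Hodge
⇒ absolute on abelian varieties; no Galois-conjugation refutation there): consistent and USED — on
abelian varieties C2 holds (Hodge-locus components through abelian fibres are special subvarieties
defined over ℚ̄), so the route's open content on AV is C1 (Weil classes over CM fields); the barrier
blocks only refutations of C2 on AV, which we do not attempt.
- Literature.Barriers.HodgeConjecture.CattaniDeligneKaplan1995_hodgeLocus_algebraicFor: an INPUT
(algebraicity of the locus); its recorded evasion "field of definition uncontrolled" is exactly crux
C2; KlinglerOtwinowskaUrbanik2023 supplies it in positive period dimension.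
- Literature.Barriers.HodgeConjecture.Serre1964_conjugateVarieties_notHomeomorphic /
Charles2009_conjugateVarieties_cohomologyAlgebrasNotIso: evaded — no Betti class is ever transported
along Aut(ℂ); C2 moves the class along an ALGEBRAIC total space (global invariant cycle theorem) and
C1 works on a fixed complex embedding.
- Literature.Barriers.HodgeConjecture.Andre1996_hodgeClassesOnAbelianVarieties_motivated: consistent
(refutation-side); a counterexample inside C1 on an abelian variety would refute standard conjecture
B — recorded as the kill criterion's cost.
- Literature.Barriers.HodgeConjecture.AtiyahHirzebruch1962_torsionClass_notAlgebraic /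
Kollar1992_nonTorsionClass_notAlgeb

Novelty grade: known — ROUTE REVIEW (refuter, 2026-08-15). Novelty KNOWN: HC ⟸ [Hodge-locus components defined over ℚ̄] + [HC over number fields] is Voisin 2007 Prop 1.7 = Charles–Schnell Thm 11.3.19 (pp.489–490 read; proof = global invariant cycle theorem with a ℚ̄-compactification). The route's delta is only the real-ca (refuter refuter-rreview-route-Langlands-LiftDesc-c79f9957-0, 2026-08-15T11:21:31Z; prior: Voisin 2007, Hodge loci and absolute Hodge classes, Compositio 143, doi:10.1112/S0010437X07002837, Prop. 1.7 / Thm 0.6, Charles–Schnell, Notes on absolute Hodge classes, in cattani2014 (held), Thm 11.3.19, Cor. 11.3.18, pp. 485–490 READ, Klingler–Otwinowska–Urbanik 2023 arXiv:2010.03359 Thm 1.12, Baldi–Klingler–Ullmo 2024)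

History (route lifecycle, newest last):
- 2026-08-15T10:50:07Z · rev 1: restated Target (stmt-HodgeConjecture-1072) — Target restated with the two crux statements inlined (the rank-0 item is rendered before the crux decls, so it cannot reference them by name) (planner-plan-HodgeConjecture-0)
- 2026-08-24T20:44:29Z · DORMANT — reconciler: no traction for 7.1 d (last activity item-evidence-added at 2026-08-17T18:45:21Z); parked, not closed — `ledger route dormant route-HodgeConjecture- (operator:999:1861994)

sub-problem: HodgeConjecture · status: dormant · opened planner-plan-HodgeConjecture-0 2026-08-15T10:49:22Z · rev 5 · ledger route-HodgeConjecture-QbarEnvelope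
GENERATED by the gate from the ledger (D-0016/17). Provers cite these decls: `theorem foo : Summit.HodgeConjecture.HodgeConjecture.Theses.QbarEnvelope.<Decl> := …` in Summits/HodgeConjecture/HodgeConjecture/Theorems/<Name>.lean.
-/

namespace Summit.HodgeConjecture.HodgeConjecture.Theses.QbarEnvelope

open scoped BigOperators Topology Manifold Classical MeasureTheory ProbabilityTheory Matrix InnerProductSpace ComplexConjugate ContinuousMap
open Filter Set Function TopologicalSpace MeasureTheory

attribute [summit_statement] _root_.HodgeConjecture

-- earlier Target (stmt-HodgeConjecture-1072, replaced 2026-08-15T10:50:07Z -> stmt-HodgeConjecture-1075): retired by None — Envelope ∧ HCOverNumberFields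
/-- item stmt-HodgeConjecture-1075 · target · rank 0 · open · by planner
why it might fail: Envelope ∧ HCOverNumberFields is sandwiched: HC ⇒ both conjuncts (spread cycles over ℚ̄-Hilbert schemes, or pull Chern-class polynomials back from products of Grassmannians) and both ⇒ HC via the Assembly; fails iff HC fails (first suspects: Weil classes; isolated transcendental Hodge-locus points).
sources: Voisin2007HodgeLoci, CharlesSchnell2014Notes Thm 11.3.19 (cattani2014 p0489)
[target] X = Envelope ∧ HCOverNumberFields (Voisin's funnel: HC over ℚ̄ plus ℚ̄-envelopes of all
Hodge classes). -/
@[route_item "route-HodgeConjecture-QbarEnvelope"]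
def Target : Prop :=
  (∀ ⦃n : ℕ⦄ ⦃X : Literature.AlgebraicGeometry.Motives.SchemeOver ℂ⦄, Literature.AlgebraicGeometry.Motives.IsSmoothProjective n X → ∀ (p : ℕ) (c : Literature.AlgebraicGeometry.HodgeTheory.complexBetti X (2 * p)), Literature.AlgebraicGeometry.HodgeTheory.IsRationalClass c → Literature.AlgebraicGeometry.HodgeTheory.IsOfHodgeType n X (2 * p) p p c → ∃ (m : ℕ) (W : Literature.AlgebraicGeometry.Motives.SchemeOver ℂ) (ι : X ⟶ W) (c' : Literature.AlgebraicGeometry.HodgeTheory.complexBetti W (2 * p)), Literature.AlgebraicGeometry.Motives.IsSmoothProjective m W ∧ (∃ (K : Type) (_ : Field K) (_ : NumberField K) (σ : K →+* ℂ) (W₀ : Literature.AlgebraicGeometry.Motives.SchemeOver K), Nonempty (W ≅ (Literature.AlgebraicGeometry.Motives.baseChangeHom σ).obj W₀)) ∧ Literature.AlgebraicGeometry.HodgeTheory.IsRationalClass c' ∧ Literature.AlgebraicGeometry.HodgeTheory.IsOfHodgeType m W (2 * p) p p c' ∧ Literature.AlgebraicGeometry.HodgeTheory.complexBetti.map ι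 (2 * p) c' = c) ∧ (∀ ⦃n : ℕ⦄ ⦃X : Literature.AlgebraicGeometry.Motives.SchemeOver ℂ⦄, Literature.AlgebraicGeometry.Motives.IsSmoothProjective n X → (∃ (K : Type) (_ : Field K) (_ : NumberField K) (σ : K →+* ℂ) (X₀ : Literature.AlgebraicGeometry.Motives.SchemeOver K), Nonempty (X ≅ (Literature.AlgebraicGeometry.Motives.baseChangeHom σ).obj X₀)) → Literature.AlgebraicGeometry.HodgeTheory.HodgeConjectureFor n X)

/-- item stmt-HodgeConjecture-1069 · crux · rank 2 · open · by planner
why it might fail: False iff some rational (p,p) class is no pull-back from a smooth projective ℚ̄-variety — forced if a Hodge-locus component of a ℚ-family is not defined over ℚ̄ (Voisin 2007; then HC fails too). Descent known only for weakly non-factor positive-dim components (KOU Thm 1.12); special points open.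
sources: Voisin2007HodgeLoci (arXiv:math/0605766: Prop. 1.2, Thm. 1.5, Cor. 1.6, Prop. 1.7), CharlesSchnell2014Notes Thm 11.3.17, Cor. 11.3.18, Thm 11.3.19 = book:cattani2014-hodge-theory-princeton-mathematical-notes-49 p0488-p0490 (read), KlinglerOtwinowskaUrbanik2023 (arXiv:2010.03359 Thm 1.12, Cor. 1.13-1.14; read p4-5), CattaniDeligneKaplan1995JAMS, BaldiKlinglerUllmo2024, Literature.Barriers.HodgeConjecture.CattaniDeligneKaplan1995_hodgeLocus_algebraicFor
[crux] ℚ̄-ENVELOPE: every rational (p,p) class c on a smooth projective complex X is ι^*c' for some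
ℂ-morphism ι : X ⟶ W into a smooth projective W definable over a number field and some rational
(p,p) class c' on W. The real-carrier OUTPUT of Voisin2007HodgeLoci Prop. 1.7 /
CharlesSchnell2014Notes Thm 11.3.19 (W = ℚ̄-compactification of the family over the Hodge-locus
component, after a finite étale base change making the class monodromy-invariant; global invariant
cycle theorem + semisimplicity). Implied by: Hodge-locus components defined over ℚ̄ ⇐ Hodge classes
(weakly) absolute Hodge (Voisin2007HodgeLoci Thm 0.5/0.6, CharlesSchnell2014Notes Thm 11.3.17);
implied by HC (algebraicity locus = countable union of ℚ̄-subvarieties). Partial results: abelian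
fibres (Deligne1982HodgeCycles), positive period dimension / level ≥ 3
(KlinglerOtwinowskaUrbanik2023 Thm 1.12, Cor. 1.13–1.14; BaldiKlinglerUllmo2024). Dark case:
isolated points of the Hodge locus (rigid pairs) at transcendental parameters. -/
@[route_item "route-HodgeConjecture-QbarEnvelope"]
def Envelope : Prop :=
  ∀ ⦃n : ℕ⦄ ⦃X : Literature.AlgebraicGeometry.Motives.SchemeOver ℂ⦄, Literature.AlgebraicGeometry.Motives.IsSmoothProjective n X → ∀ (p : ℕ) (c : Literature.AlgebraicGeometry.HodgeTheory.complexBetti X (2 * p)), Literature.AlgebraicGeometry.HodgeTheory.IsRationalClass c → Literature.AlgebraicGeometry.HodgeTheory.IsOfHodgeType n X (2 * p) p p c → ∃ (m : ℕ) (W : Literature.AlgebraicGeometry.Motives.SchemeOver ℂ) (ι : X ⟶ W) (c' : Literature.AlgebraicGeometry.HodgeTheory.complexBetti W (2 * p)), Literature.AlgebraicGeometry.Motives.IsSmoothProjective m W ∧ (∃ (K : Type) (_ : Field K) (_ : NumberField K) (σ : K →+* ℂ) (W₀ : Literature.AlgebraicGeometry.Motives.SchemeOver K), Nonempty (W ≅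 (Literature.AlgebraicGeometry.Motives.baseChangeHom σ).obj W₀)) ∧ Literature.AlgebraicGeometry.HodgeTheory.IsRationalClass c' ∧ Literature.AlgebraicGeometry.HodgeTheory.IsOfHodgeType m W (2 * p) p p c' ∧ Literature.AlgebraicGeometry.HodgeTheory.complexBetti.map ι (2 * p) c' = c

/-- item stmt-HodgeConjecture-1070 · crux · rank 3 · open · by planner
why it might fail: It is HC on ℚ̄-varieties: open already for Weil classes on Weil-type abelian varieties over ℚ̄ (e.g. CM) from dim 6 on (sixfolds off disc −1: Markman 2025; arXiv:2603.20268 §1); failure there also refutes standard conjecture B (André). As typed it also asks Nonempty (HodgeModel n X) (open fact).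
sources: Deligne1982HodgeCycles, Markman2025SecantWeil (arXiv:2502.03415 §1.1), 2603.20268 (§1: Weil classes on sixfolds open off discriminant -1; read p3), Andre1996Motifs (Thm 0.6.2, §6.3 Remarque 2), Literature.Barriers.HodgeConjecture.Weil1977_exceptionalHodgeClasses, Literature.Barriers.HodgeConjecture.Andre1996_hodgeClassesOnAbelianVarieties_motivated
[crux] The Hodge conjecture for smooth projective complex varieties definable over a number field (X
≅ X₀ ⊗_{K,σ} ℂ). Here a Hodge class has arithmetic incarnations absent at transcendental points: an
algebraic de Rham class over a finite extension of K (CharlesSchnell2014Notes Cor. 11.3.16 for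
absolute classes), crystalline Frobenii at good primes, one ℓ-adic Galois representation (Hodge ⇒
Tate under absoluteness; Tate + Mumford–Tate ⇒ HC for X/K, Moonen2017FamiliesMotives), p-adic
variational Hodge (BlochEsnaultKerz2014pAdic). Decisive open sub-family: CM abelian varieties of
Weil type (all over ℚ̄; by Deligne1982HodgeCycles + André 1992 every Hodge class on a CM abelian
variety comes from Weil classes) — algebraic in dim 4 and partly 6 (Markman2025SecantWeil,
arXiv:2603.20268), open beyond. -/
@[route_item "route-HodgeConjecture-QbarEnvelope"]
def HCOverNumberFields : Prop :=
  ∀ ⦃n : ℕ⦄ ⦃X : Literature.AlgebraicGeometry.Motives.SchemeOver ℂ⦄, Literature.AlgebraicGeometry.Motives.IsSmoothProjective n X → (∃ (K : Type) (_ : Field K) (_ : NumberField K) (σ : K →+* ℂ) (X₀ : Literature.AlgebraicGeometry.Motives.SchemeOver K), Nonempty (X ≅ (Literature.AlgebraicGeometry.Motives.baseChangeHom σ).obj X₀)) → Literature.AlgebraicGeometry.HodgeTheory.HodgeConjectureFor n X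

/-- item stmt-HodgeConjecture-1071 · support · rank 9 · closed · proved by Summit.HodgeConjecture.HodgeConjecture.Theorems.boundaryReadout_pullbackAlgebraic_of_constantLift @ dac484460e49 (prover) · by planner
sources: Fulton1998 (Ch. 6, §8.1, Cor. 19.2 / Prop. 19.2.2), VoisinHodgeII2003 (Prop. 9.21)
[support] Pull-back along a ℂ-morphism ι : X ⟶ W of smooth projective varieties preserves algebraic
classes: ι^*(Nᵖ H^{2p}(W(ℂ);ℂ)) ⊆ Nᵖ H^{2p}(X(ℂ);ℂ). Theorem in print: purity H^{2p}_T(W) spanned by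
classes of codim-p components (Fulton §19.1), refined Gysin pull-back ι^! : CH_*(W) → CH_*(X) for W
smooth (Fulton Ch. 6 and §8.1, no moving lemma needed) and compatibility cl(ι^! z) = ι^* cl(z)
(Fulton Cor. 19.2 / Prop. 19.2.2); on the tree's carriers it needs the cycle class with supports
(same obligation as HodgeTheory/AlgebraicClassesCup 'moving' hypothesis). -/
@[route_item "route-HodgeConjecture-QbarEnvelope"]
def PullbackAlgebraic : Prop :=
  ∀ ⦃n : ℕ⦄ ⦃X : Literature.AlgebraicGeometry.Motives.SchemeOver ℂ⦄, Literature.AlgebraicGeometry.Motives.IsSmoothProjective n X → ∀ ⦃m : ℕ⦄ ⦃W : Literature.AlgebraicGeometry.Motives.SchemeOver ℂ⦄, Literature.AlgebraicGeometry.Motives.IsSmoothProjective m W → ∀ (ι : X ⟶ W) (p : ℕ) (c' : Literature.AlgebraicGeometry.HodgeTheory.complexBetti W (2 * p)), c' ∈ Literature.AlgebraicGeometry.HodgeTheory.algebraicClasses W p → Literature.AlgebraicGeometry.HodgeTheory.complexBetti.map ι (2 * p) c' ∈ Literature.AlgebraicGeometry.HodgeTheory.algebraicClasses X p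

/-- item stmt-HodgeConjecture-14229 · support · rank 9 · closed · proved by Summit.HodgeConjecture.HodgeConjecture.Theorems.qbarEnvelope_targetOfCruxes_proof @ 4302f6c812f7 (prover) · by planner
[support] GLUE Crux… → Target (route-choice repair, target-unreachable hold 2026-08-16): the target
X = Envelope ∧ HCOverNumberFields is, by construction (rev 1 restated Target with the two crux
statements inlined verbatim, because the rank-0 item is rendered before the crux decls), exactly the
conjunction of the two cruxes; this item records the implication Envelope → HCOverNumberFields →
Target so that the target is concluded by an item of the route. Routine, provable now by one line of
logic after delta-unfolding: `fun h₁ h₂ => ⟨h₁, h₂⟩` (planner Sketch.lean, lean check rc 0, 0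
sorries, 2026-08-16). With it Target lies on the closing chain: closes hT.1 hT.2 hP hM :
HodgeConjecture. Sources: route file rev 1 history (Target = inlined Envelope ∧ HCOverNumberFields);
Voisin2007HodgeLoci Prop. 1.7; CharlesSchnell2014Notes Thm 11.3.19. -/
@[route_item "route-HodgeConjecture-QbarEnvelope"]
def TargetOfCruxes : Prop :=
  Envelope → HCOverNumberFields → Target

/-- item stmt-HodgeConjecture-1943 · support · rank 9 · closed · proved by Summit.HodgeConjecture.HodgeConjecture.Theorems.nodalSupport_hodgeModels_proof @ 6468568b8792 (prover) · by planner
sources: SerreGAGA1956, SGA1, WellsDACM1980, VoisinHodgeI2002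
[support] needs-fact: Literature.AlgebraicGeometry.HodgeTheory.nonempty_hodgeModel (route-repair,
cone guardrail 2026-08-15). GENUINELY needed: `Nonempty (HodgeModel n X)` is conjunct 1 of
HodgeTheory.HodgeConjectureFor, i.e. part of the summit statement itself, so every route to
HodgeConjecture must produce it. This decl is VERBATIM the first antecedent of this route's Assembly
(and of NodalSupport's and QbarEnvelope's — re-ask this exact signature there to share the item); it
is filed as an item so that the closing chain is items-only (`Assembly_holds HodgeModels_holds
IsoInvariance_holds VariationalHodge_holds AnchorExistence_holds : HodgeConjecture` typechecks with
no unfolding; planner Sketch.lean rc 0, where `HodgeModels ↔ ∀ n X, IsSmoothProjective n X →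
Nonempty (HodgeModel n X)` is Iff.rfl) and so that the fact is named in the ledger as tier-0 debt of
the summit. HOW IT CLOSES: one line, `fun n X => nonempty_hodgeModel_holds`, once the Literature
fact is discharged — the reduction is already in tree:
HodgeModelExistenceDischarge.nonempty_hodgeModel_of_deRham_of_hodgeDecomposition (remaining leaves:
the real de Rham theorem exists_deRhamIsoFamily and the Hodge decomposition -/
@[route_item "route-HodgeConjecture-QbarEnvelope"]
def HodgeModels : Prop :=
  ∀ (n : ℕ) (X : Literature.AlgebraicGeometry.Motives.SchemeOver ℂ), Literature.AlgebraicGeometry.HodgeTheory.nonempty_hodgeModel n X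

/-- `HodgeModels` holds: proved by `Summit.HodgeConjecture.HodgeConjecture.Theorems.nodalSupport_hodgeModels_proof` @ 6468568b8792. -/
theorem HodgeModels_holds : HodgeModels := _root_.Summit.HodgeConjecture.HodgeConjecture.Theorems.nodalSupport_hodgeModels_proof

/-- item stmt-HodgeConjecture-1073 · assembly · rank 1 · closed · proved by Summit.HodgeConjecture.HodgeConjecture.Theorems.qbarEnvelope_assembly_proof @ 6fbee03b00bb (prover) · by planner
[assembly] Given X smooth projective: the first conjunct of HodgeConjectureFor is the antecedent
fact nonempty_hodgeModel; for a rational (p,p) class c take the envelope (m, W, ι, c'); W is smooth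
projective and definable over a number field so HCOverNumberFields gives c' ∈ algebraicClasses W p;
PullbackAlgebraic gives c = ι^*c' ∈ algebraicClasses X p. Pure logic; provable now. -/
@[route_item "route-HodgeConjecture-QbarEnvelope"]
def Assembly : Prop :=
  (∀ (n : ℕ) (X : Literature.AlgebraicGeometry.Motives.SchemeOver ℂ), Literature.AlgebraicGeometry.HodgeTheory.nonempty_hodgeModel n X) → PullbackAlgebraic → Envelope → HCOverNumberFields → _root_.HodgeConjecture

/-! D-0027 §2.1 — DECIDING THEOREM (planner-authored via `route open/edit --closes-file`; by planner-rbadge-HodgeConjecture-QbarEnvelope-1d4f84bc-g2-0 2026-08-15T16:11:45Z):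
its hypotheses are this route's items and its conclusion the sub-problem Statement (glue_lint), and it elaborates with this file. -/

@[closes "route-HodgeConjecture-QbarEnvelope"] theorem closes (hE : Envelope) (hC : HCOverNumberFields) (hP : PullbackAlgebraic)
    (hM : HodgeModels) : _root_.HodgeConjecture := by
  intro n X hX
  refine ⟨hM n X hX, fun p c hc hpp => ?_⟩
  obtain ⟨m, W, ι, c', hW, hWK, hc', hpp', rfl⟩ := hE hX p c hc hpp
  exact hP hX hW ι p c' ((hC hW hWK).2 p c' hc' hpp')

end Summit.HodgeConjecture.HodgeConjecture.Theses.QbarEnvelope
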